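import Literature.NumberTheory.Automorphic.CDTTheorem722
import Literature.NumberTheory.Automorphic.HeckeAlgebraOfTypeSigma
import Literature.NumberTheory.EllipticCurves.ManinConstantQuadraticTwistClassCertificate
import Literature.NumberTheory.EllipticCurves.TateModuleContinuityProofs
import Literature.NumberTheory.EllipticCurves.TateModuleFreeProofs
import Literature.NumberTheory.EllipticCurves.FrobeniusTateModuleProofs
import Literature.NumberTheory.EllipticCurves.NeronOggShafarevich
import Literature.NumberTheory.GaloisRepresentations.FramedRepBaseChange
import Literature.NumberTheory.Automorphic.HilbertResidualModularity
import Mathlib.RingTheory.Flat.Basic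
import Mathlib.RingTheory.LocalRing.ResidueField.Basic
import Mathlib.RingTheory.MvPowerSeries.Basic
import HarnessLib

/-!
# STUB-IDEAS k2 (RESHAPE) — typed helper statements for `stub_liftThree` (generation 2)

Typed helper statements of the stub-ideation seat `sidea-stmt-ABC-11340-stub_liftThree-2` (g2
revision of the g1 file of the same name). Every `sorry` below is a PROPOSED HELPER LEMMA (one
prover cycle each, sizes in `STUB-IDEAS-stub_liftThree-2.md`); the `_of_` closers are sorry-free
and show how the helpers / named facts re-assemble the registered stub signature verbatim.

g2 changes: H3b is no longer restated (it IS the tree's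
`WeierstrassCurve.IsTorsionGaloisRep.exists_conj_eq`, cited by an `example`); §6 is new — the
de Smit–Rubin–Schoof **Criterion II** engine (Lemma 4.1, Corollary 4.2, Criterion II in Rubin's
ONE-LEVEL form: no patching limit), typed over Mathlib + the tree's `IsCompleteIntersectionOver`;
it is the reusable algebra half of the minimal `R_∅ = T_∅` step (F_B2) of Plan B★ — the tree's
`NumericalCriterion.lean` lists Criterion II under "Not here" while Criterion I is proved
(`numericalCriterion_le_holds`, `bijective_of_length_cotangentModule_le`).
-/

universe u v

noncomputable section

open scoped MatrixGroups NumberField Polynomial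
open Field IsDedekindDomain Polynomial Rat.HeightOneSpectrum CongruenceSubgroup
open Literature.NumberTheory.GaloisRepresentations
open Literature.NumberTheory.EllipticCurves Literature.NumberTheory.EllipticCurves.ModularForms
open Literature.NumberTheory.Automorphic Literature.NumberTheory.Automorphic.BCDT
open WeierstrassCurve

namespace Summit.ABC.ABC.Cruxes.FreyModularity.StubIdeas2

/-! ## 0. The registered stub, verbatim, as a Prop (target of every plan) -/

/-- The registered signature of `stub_liftThree` (skeleton `Lines/Sketch.lean`). -/
def LiftThree : Prop :=
  ∀ (W : WeierstrassCurve ℚ) [W.IsElliptic] (ρ : ModPGaloisRep ℚ (ZMod 3) 2),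
    W.IsTorsionGaloisRep 3 ρ → ρ.IsAbsIrreducibleOverSqrt (-3) → ¬ 9 ∣ W.conductorNorm ℤ →
      ρ.IsModular → W.IsModularGaloisRepTate 3

/-! ## 1. Regime split at 3 (axis forced by the tree's `modularLiftsOfTypeSigma`, which demands
level prime to `p`): `9 ∤ N` ⇔ good (flat regime I) or multiplicative (ordinary regime II) at 3. -/

/-- Regime I: `W` has good reduction at `3` (then `ρ_{W,3}|G₃` is finite flat). -/
def LiftThreeGood : Prop :=
  ∀ (W : WeierstrassCurve ℚ) [W.IsElliptic] (ρ : ModPGaloisRep ℚ (ZMod 3) 2),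
    W.IsTorsionGaloisRep 3 ρ → ρ.IsAbsIrreducibleOverSqrt (-3) → W.HasGoodReductionAtPrime 3 →
      ρ.IsModular → W.IsModularGaloisRepTate 3

/-- Regime II: `W` has multiplicative reduction at `3` (Tate curve: `ρ_{W,3}|G₃` ordinary,
the weight-2 newform has `3 ∥ M`). -/
def LiftThreeMult : Prop :=
  ∀ (W : WeierstrassCurve ℚ) [W.IsElliptic] (ρ : ModPGaloisRep ℚ (ZMod 3) 2),
    W.IsTorsionGaloisRep 3 ρ → ρ.IsAbsIrreducibleOverSqrt (-3) →
      W.HasMultiplicativeReductionAtPrime 3 → ρ.IsModular → W.IsModularGaloisRepTate 3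

/-- GLUE (proved): the two regimes re-assemble the stub, via the tree's
`hasGoodReductionAtPrime_or_hasMultiplicativeReductionAtPrime_of_not_sq_dvd_conductorNorm`. -/
theorem liftThree_of_regimes (hI : LiftThreeGood) (hII : LiftThreeMult) : LiftThree := by
  intro W _ ρ hρ hirr h9 hmod
  have h9' : ¬ 3 ^ 2 ∣ W.conductorNorm ℤ := by simpa using h9
  rcases hasGoodReductionAtPrime_or_hasMultiplicativeReductionAtPrime_of_not_sq_dvd_conductorNorm
      (V := W) h9' with hg | hm
  · exact hI W ρ hρ hirr hg hmod
  · exact hII W ρ hρ hirr hm hmod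

/-! ## 2. The EC ↦ framed-Galois dictionary (helpers H2–H7) -/

section Frame

variable (W : WeierstrassCurve ℚ) [W.IsElliptic]
  [Module.Finite ℤ_[3] (W.tateModule 3)] [IsModuleTopology ℤ_[3] (W.tateModule 3)]

/-- H2 (definitional, pattern `coe_tateFrame_apply` of BSD/TelescopeBranchZeroFibreOfFrobCharpoly):
the integral 3-adic Tate frame `[T₃W]_b : Γ_ℚ →ₜ* GL₂(ℤ₃)`. -/
abbrev tateFrame (b : Module.Basis (Fin 2) ℤ_[3] (W.tateModule 3)) : FramedGaloisRep ℚ ℤ_[3] 2 :=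
  (WeierstrassCurve.tateGaloisRep W 3 (W.continuous_galoisRepTate_holds 3)).frame b

/-- H2': the matrix of the frame is `[ρ_{W,3}(σ)]_b`. [folklore] -/
theorem coe_tateFrame_apply (b : Module.Basis (Fin 2) ℤ_[3] (W.tateModule 3))
    (σ : absoluteGaloisGroup ℚ) :
    (((tateFrame W b σ : GL (Fin 2) ℤ_[3])) : Matrix (Fin 2) (Fin 2) ℤ_[3]) =
      LinearMap.toMatrix b b (W.galoisRepTate 3 σ) :=
  ContinuousRep.coe_frame_apply _ b σ

/-- H3 (size M): the entrywise reduction mod 3 of the Tate frame is a framed model of `W[3]`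
(`T₃W/3T₃W ≅ W[3]` equivariantly). The proof is INSIDE the tree's
`IsTorsionGaloisRep.charpoly_eq_map_charpoly_galoisRepTate` (BCDTModularityModPProofs: the images of
a `ℤ₃`-basis of `T₃W` span `W[3]`, `proj_surjective_of_isAlgClosed_holds`, `proj_eq_sum_repr`) — extract
the frame `e : W[3] ≃+ (Fin 2 → ZMod 3)` built there instead of passing to charpolys; other patterns
`toZModPow_det_galoisRepTate_eq`, `trace_galoisRepTorsion_eq_toZMod_trace_galoisRepTate`.
[Silverman AEC III.7] -/
theorem exists_isTorsionGaloisRep_reduction_tateFrame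
    (b : Module.Basis (Fin 2) ℤ_[3] (W.tateModule 3)) :
    ∃ ρ₃ : ModPGaloisRep ℚ (ZMod 3) 2, W.IsTorsionGaloisRep 3 ρ₃ ∧
      ∀ σ : absoluteGaloisGroup ℚ,
        ((ρ₃ σ : GL (Fin 2) (ZMod 3)) : Matrix (Fin 2) (Fin 2) (ZMod 3)) =
          ((((tateFrame W b σ : GL (Fin 2) ℤ_[3])) : Matrix (Fin 2) (Fin 2) ℤ_[3]).map
            (PadicInt.toZMod (p := 3))) := by
  sorry

/-- H3b is ALREADY IN THE TREE (g1 restated it; g2 cites): any two framed models of `W[3]` are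
`GL₂(𝔽₃)`-conjugate = `WeierstrassCurve.IsTorsionGaloisRep.exists_conj_eq`
(HilbertResidualModularity.lean, proved). -/
example (ρ ρ' : ModPGaloisRep ℚ (ZMod 3) 2) (h : W.IsTorsionGaloisRep 3 ρ)
    (h' : W.IsTorsionGaloisRep 3 ρ') : ∃ P : GL (Fin 2) (ZMod 3), ρ' = FramedRep.conj P ρ :=
  h.exists_conj_eq h'

/-- H3c (size S): `IsModular` is conjugation invariant — port the tree's PROVED Hilbert analogue
`ModPGaloisRep.IsHilbertModular.conj` (HilbertResidualModularity.lean) to the classical-newform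
predicate (`FramedRep.baseChange_conj`, `isUnramifiedAt`/`charpoly` conj-invariance in
`FramedRepBaseChange`). [folklore] -/
theorem isModular_conj (ρ : ModPGaloisRep ℚ (ZMod 3) 2) (P : GL (Fin 2) (ZMod 3))
    (h : ρ.IsModular) : ModPGaloisRep.IsModular (k := ZMod 3) (FramedRep.conj P ρ) := by
  sorry

/-- H3d (size S): `IsAbsIrreducibleOverSqrt d` is conjugation invariant. [folklore] -/
theorem isAbsIrreducibleOverSqrt_conj (d : ℚ) (ρ : ModPGaloisRep ℚ (ZMod 3) 2)
    (P : GL (Fin 2) (ZMod 3)) (h : ρ.IsAbsIrreducibleOverSqrt d) :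
    ModPGaloisRep.IsAbsIrreducibleOverSqrt (k := ZMod 3) d (FramedRep.conj P ρ) := by
  sorry

/-- H4 (size S): `det [T₃W]_b = χ₃` — from the PROVED `det_galoisRepTate_eq_cyclotomicCharacter_holds`
and `LinearMap.det_toMatrix`. [Silverman AEC III.8.3] -/
theorem det_tateFrame (b : Module.Basis (Fin 2) ℤ_[3] (W.tateModule 3)) (σ : absoluteGaloisGroup ℚ) :
    (((tateFrame W b σ : GL (Fin 2) ℤ_[3])) : Matrix (Fin 2) (Fin 2) ℤ_[3]).det =
      ((GaloisRep.cyclotomicCharacter ℚ 3 σ : ℤ_[3]ˣ) : ℤ_[3]) := by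
  sorry

/-- H5 (size S): the Tate frame is unramified at every `p ∤ 3·N_W` (Néron–Ogg–Shafarevich, easy
direction, tree `isUnramifiedAt_tateGaloisRep` + `GaloisRep.isUnramifiedAt_frame_iff` +
`dvd_conductorNorm_iff`). [Silverman AEC VII.7.1] -/
theorem isUnramifiedAt_tateFrame (b : Module.Basis (Fin 2) ℤ_[3] (W.tateModule 3))
    (v : HeightOneSpectrum (𝓞 ℚ)) (hv : ¬ ((primesEquiv v : ℕ) ∣ 3 * W.conductorNorm ℤ)) :
    (tateFrame W b).IsUnramifiedAt v := by
  sorry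

/-- H6 (size XS from H5 + `IsUnramifiedAt.isMinimallyRamifiedAt`): hence minimally ramified there,
i.e. `ρ_{W,3}` is "of type `Σ_W = {p ∣ N_W}`" away from 3 in the sense of `modularLiftsOfTypeSigma`. -/
theorem isMinimallyRamifiedAt_tateFrame (b : Module.Basis (Fin 2) ℤ_[3] (W.tateModule 3))
    (v : HeightOneSpectrum (𝓞 ℚ)) (hv : ¬ ((primesEquiv v : ℕ) ∣ 3 * W.conductorNorm ℤ)) :
    (tateFrame W b).IsMinimallyRamifiedAt v :=
  (isUnramifiedAt_tateFrame W b v hv).isMinimallyRamifiedAt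

/-- H7 (size M/L, THE END OF EVERY R=T ROAD): if some base change `[T₃W]_b ⊗ Ō` to a characteristic-0
local domain is attached (integrally, away from `3M`) to a weight-2 newform `g` of level `M`, then
`W.IsModularGaloisRepTate 3` (pass to `Frac Ō ⊇ ℚ₃`, extend `j` to `K_g`, transport Frobenius
charpolys through `hasFrobCharpolyAt_tateFrame_iff` / `FramedRep.charpoly_baseChange`).
Level `M` may be divisible by 3 (serves both regimes). [CDT1999 §5.1; DDT1995 Thm 3.1] -/
theorem isModularGaloisRepTate_of_newform_tateFrame [Module.Free ℤ_[3] (W.tateModule 3)]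
    (b : Module.Basis (Fin 2) ℤ_[3] (W.tateModule 3))
    {Ō : Type} [CommRing Ō] [IsDomain Ō] [CharZero Ō] [TopologicalSpace Ō] [IsTopologicalRing Ō]
    [Algebra ℤ_[3] Ō] (hc : Continuous (algebraMap ℤ_[3] Ō))
    {M : ℕ} [NeZero M] (g : CuspForm (Gamma1 M) 2) (j : coeffCharIntegers g →+* Ō)
    (hg : IsNewform1 g)
    (h : IsGaloisRepOfNewform1Int g j {r | r ∣ M * 3}
      (FramedRep.baseChange (algebraMap ℤ_[3] Ō) hc (tateFrame W b))) :
    W.IsModularGaloisRepTate 3 := by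
  sorry

end Frame

/-! ## 3. Plan A — the Galois-form lifting atom (Diamond 1996 Thm 5.3 = CSS1997 ch. XVII Cor 6.2 at ℓ = 3),
curve-tied only in the local condition at 3. -/

/-- NAMED FACT request F_A (to be seated in `Literature/NumberTheory/Automorphic/`): Diamond, Ann. of
Math. 144 (1996) Thm 5.3 / Cornell–Silverman–Stevens ch. "An extension of Wiles' results" Thm 6.1 +
Cor 6.2, at `ℓ = 3`, for `ρ = ρ_{W,3}`: `W` good or multiplicative at 3, `ρ̄|ℚ(√-3)` absolutely
irreducible, `ρ̄` modular ⟹ `ρ_{W,3}` modular. Residual modularity stays an explicit hypothesis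
(unlike the bundled `CDT_theorem_7_2_1`). -/
def DiamondThm53AtThree : Prop :=
  ∀ (W : WeierstrassCurve ℚ) [W.IsElliptic] (ρ : ModPGaloisRep ℚ (ZMod 3) 2),
    W.IsTorsionGaloisRep 3 ρ →
      (W.HasGoodReductionAtPrime 3 ∨ W.HasMultiplicativeReductionAtPrime 3) →
        ρ.IsAbsIrreducibleOverSqrt (-3) → ρ.IsModular → W.IsModularGaloisRepTate 3

/-- Plan A closer (proved): F_A ⟹ both regimes ⟹ the stub. -/
theorem liftThree_of_DiamondThm53 (hA : DiamondThm53AtThree) : LiftThree :=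
  liftThree_of_regimes (fun W _ ρ hρ hirr hg hmod => hA W ρ hρ (Or.inl hg) hirr hmod)
    (fun W _ ρ hρ hirr hm hmod => hA W ρ hρ (Or.inr hm) hirr hmod)

/-! ## 4. Plan B — regime I through the tree's type-Σ Hecke algebra (`modularLiftsOfTypeSigma 3 2 Ō ρ S`)
and the PROVED numerical criterion; engines are named facts. -/

/-- F_B1 (Diamond CSS1997 Thm 5.1, "ρ̄ modular ⟹ Φ_∅ ≠ ∅", at ℓ = 3, flat case): a MINIMAL weight-2
modular lift of `ρ̄ = ρ̄_{W,3}` exists, as a member of `N_∅([T₃W]_b)` over some 3-adic coefficient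
ring. Inputs in print: Ribet level-lowering, Carayol, multiplicity one, companion forms avoided since
`ℓ = 3 ∤ N(ρ̄)`-optimisation is by Diamond–Taylor. -/
def MinimalModularLiftThree : Prop :=
  ∀ (W : WeierstrassCurve ℚ) [W.IsElliptic]
    [Module.Finite ℤ_[3] (W.tateModule 3)] [IsModuleTopology ℤ_[3] (W.tateModule 3)]
    (b : Module.Basis (Fin 2) ℤ_[3] (W.tateModule 3)) (ρ : ModPGaloisRep ℚ (ZMod 3) 2),
    W.IsTorsionGaloisRep 3 ρ → W.HasGoodReductionAtPrime 3 → ρ.IsAbsIrreducibleOverSqrt (-3) →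
      ρ.IsModular →
        ∃ (Ō : Type) (_ : CommRing Ō) (_ : IsLocalRing Ō) (_ : IsDomain Ō) (_ : CharZero Ō)
          (_ : TopologicalSpace Ō) (_ : IsTopologicalRing Ō) (_ : Algebra ℤ_[3] Ō),
          Continuous (algebraMap ℤ_[3] Ō) ∧
            (modularLiftsOfTypeSigma 3 2 Ō (tateFrame W b) ∅).Nonempty

/-- F_BΣ (DDT1995 Thm 3.42 ⊕ Diamond 1996 §§4–5 at ℓ = 3, flat case, SPECIALISED to the point
`ρ_{W,3}` of `R_Σ`, `Σ = {p ∣ N_W}`): if `ρ̄_{W,3}` has a minimal modular lift then `[T₃W]_b ⊗ Ō`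
itself lies in `N_Σ`. Hidden inside: `ρ_{W,3}` is a type-Σ lift (flat at 3 by Fontaine–Raynaud,
`det = χ₃` by H4, minimally ramified off Σ by H6) and `R_Σ ↠ T_Σ` is an isomorphism (minimal case by
Taylor–Wiles patching, induction on Σ by the numerical criterion — `numericalCriterion_le_holds`,
`bijective_of_length_cotangentModule_le` are PROVED in the tree — fed by DDT Thm 3.36 (Ihara, η-side)
and Cor 3.37 (Selmer side)). -/
def TypeSigmaLiftThree : Prop :=
  ∀ (W : WeierstrassCurve ℚ) [W.IsElliptic]
    [Module.Finite ℤ_[3] (W.tateModule 3)] [IsModuleTopology ℤ_[3] (W.tateModule 3)]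
    (b : Module.Basis (Fin 2) ℤ_[3] (W.tateModule 3))
    {Ō : Type} [CommRing Ō] [IsLocalRing Ō] [IsDomain Ō] [CharZero Ō] [TopologicalSpace Ō]
    [IsTopologicalRing Ō] [Algebra ℤ_[3] Ō] (hc : Continuous (algebraMap ℤ_[3] Ō)),
    W.HasGoodReductionAtPrime 3 →
      (modularLiftsOfTypeSigma 3 2 Ō (tateFrame W b) ∅).Nonempty →
        FramedRep.baseChange (algebraMap ℤ_[3] Ō) hc (tateFrame W b) ∈
          modularLiftsOfTypeSigma 3 2 Ō (tateFrame W b) {p | p ∣ W.conductorNorm ℤ}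

/-- H7 packaged as a Prop (so the regime-I closer below is sorry-free). -/
def NewformFrameGivesTate : Prop :=
  ∀ (W : WeierstrassCurve ℚ) [W.IsElliptic]
    [Module.Finite ℤ_[3] (W.tateModule 3)] [IsModuleTopology ℤ_[3] (W.tateModule 3)]
    (b : Module.Basis (Fin 2) ℤ_[3] (W.tateModule 3))
    {Ō : Type} [CommRing Ō] [IsDomain Ō] [CharZero Ō] [TopologicalSpace Ō] [IsTopologicalRing Ō]
    [Algebra ℤ_[3] Ō] (hc : Continuous (algebraMap ℤ_[3] Ō))
    {M : ℕ} [NeZero M] (g : CuspForm (Gamma1 M) 2) (j : coeffCharIntegers g →+* Ō),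
    IsNewform1 g →
      IsGaloisRepOfNewform1Int g j {r | r ∣ M * 3}
        (FramedRep.baseChange (algebraMap ℤ_[3] Ō) hc (tateFrame W b)) →
      W.IsModularGaloisRepTate 3

/-- Plan B, regime I closer (proved): F_B1 → F_BΣ → H7 → `LiftThreeGood`. -/
theorem liftThreeGood_of_planB (hB1 : MinimalModularLiftThree) (hBS : TypeSigmaLiftThree)
    (h7 : NewformFrameGivesTate) : LiftThreeGood := by
  intro W _ ρ hρ hirr hg hmod
  haveI : Module.Finite ℤ_[3] (W.tateModule 3) := module_finite_tateModule_holds W 3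
  haveI : IsModuleTopology ℤ_[3] (W.tateModule 3) :=
    TateModule.isModuleTopology (A := geomPoints W) (p := 3)
  haveI : Module.Free ℤ_[3] (W.tateModule 3) := module_free_tateModule_holds W 3
  have hrank : Module.finrank ℤ_[3] (W.tateModule 3) = 2 :=
    finrank_tateModule_eq_two_holds W 3 (by norm_num)
  obtain ⟨b⟩ : Nonempty (Module.Basis (Fin 2) ℤ_[3] (W.tateModule 3)) :=
    ⟨Module.finBasisOfFinrankEq ℤ_[3] (W.tateModule 3) hrank⟩
  obtain ⟨Ō, _, _, _, _, _, _, _, hc, hne⟩ := hB1 W b ρ hρ hg hirr hmod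
  have hmem := hBS W b hc hg hne
  obtain ⟨⟨M, hM, g, j, hg1, -, hgal⟩, -, -, -⟩ := (mem_modularLiftsOfTypeSigma_iff).mp hmem
  exact h7 W b hc g j hg1 hgal

/-! ## 5. Plan C — lossy rung (weaken-and-bootstrap): the MINIMAL case only. -/

/-- Rung C (Wiles 1995 Thm 0.2-shape at ℓ = 3, minimal case): the stub for `W` SEMISTABLE with
`ρ_{W,3}` a minimally ramified lift of `ρ̄` at every `p ≠ 3` (for `p ∥ N`: `3 ∤ v_p(Δ_min)`),
typed through `IsMinimallyRamifiedAt` of the frame so no valuation bookkeeping is needed. The loss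
(non-minimal primes) is removed by F_BΣ's numerical-criterion induction. -/
def LiftThreeMinimal : Prop :=
  ∀ (W : WeierstrassCurve ℚ) [W.IsElliptic]
    [Module.Finite ℤ_[3] (W.tateModule 3)] [IsModuleTopology ℤ_[3] (W.tateModule 3)]
    (b : Module.Basis (Fin 2) ℤ_[3] (W.tateModule 3)) (ρ : ModPGaloisRep ℚ (ZMod 3) 2),
    W.IsTorsionGaloisRep 3 ρ → ρ.IsAbsIrreducibleOverSqrt (-3) → W.HasGoodReductionAtPrime 3 →
      (∀ v : HeightOneSpectrum (𝓞 ℚ), (primesEquiv v : ℕ) ≠ 3 → (tateFrame W b).IsMinimallyRamifiedAt v) →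
        ρ.IsModular → W.IsModularGaloisRepTate 3

/-! ## 6. NEW IN g2 — the de Smit–Rubin–Schoof Criterion II engine (strengthen-to-simplify the
MINIMAL case F_B2 `R_∅ ≅ T_∅`): Rubin's one-level proof, [DeSmitRubinSchoof1997, §4, Lemma 4.1,
Cor. 4.2, proof of Criterion II] = [corpus:book:cornell1997-modular-forms-fermats-last-theorem
PDF pp. 414 (statement), 423–425 (§4)]. Pure commutative algebra over Mathlib's
`MvPowerSeries (Fin n) O` (the tree's `IsCompleteIntersectionOver` is spelled out in E2c). The "S-structure"
`O[[S]] → A` is the `Algebra (MvPowerSeries (Fin n) O) A` instance, the "X-structure" `O[[X]] ↠ A`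
is the explicit surjection `f`; Rubin lifts the HOMOMORPHISM `O[[S]] → R_m` to `O[[S]] → O[[X]]`,
but his proof only uses lifts `t i` of the ELEMENTS `S_i`, which is how the lemmas are typed (no
continuity / substitution API needed). -/

section DRS

open IsLocalRing

variable (O : Type u) [CommRing O] (p : ℕ)

/-- `ω_m(S_i) = (1 + S_i)^{p^m} - 1 ∈ O[[S_1, …, S_n]]` (DRS p. 345). -/
def omega (n m : ℕ) (i : Fin n) : MvPowerSeries (Fin n) O :=
  (1 + MvPowerSeries.X i) ^ (p ^ m) - 1

/-- `J_m = (ω_m(S_1), …, ω_m(S_n))`; `J_0 = (S_1, …, S_n)` (DRS p. 345). -/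
def J (n m : ℕ) : Ideal (MvPowerSeries (Fin n) O) := Ideal.span (Set.range (omega O p n m))

/-- Sanity (proved): `J_0 = (S_1, …, S_n)`. -/
theorem J_zero (n : ℕ) :
    J O p n 0 = Ideal.span (Set.range (MvPowerSeries.X : Fin n → MvPowerSeries (Fin n) O)) := by
  have h : omega O p n 0 = MvPowerSeries.X := by
    funext i
    simp [omega]
  rw [J, h]

/-- **E2a = DRS Lemma 4.1** (size M/L; field case). `k` a field, `n ≥ 1`, `A` a `k`-algebra with an
"S-structure" `k[[S]] → A` (the `MvPowerSeries`-algebra instance) and a SURJECTIVE "X-structure"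
`f : k[[X]] ↠ A`; `t i ∈ k[[X]]` lifts of the images `s_i` of the `S_i`; `d = dim_k A/(s)A`;
`N > n^{n-1} d^n`; the induced `k[[S]]/(S_i^N) → A/(s_i^N)A` injective (typed as the `comap`
inclusion). Then `ker f ⊆ (t_1, …, t_n)`, i.e. `k[[X]]/(t) ≅ A/(s)A`. Proof (Rubin, p. 354):
`I^d ⊆ J + (t)` by length, an `α ∈ J \ I^{d+1}` would give `dim ker(α·) = dim coker(α·)` on
`k[[X]]/I^{ndN}` with `coker ↠ A/(s^N)A` of dimension `≥ N^n` but `ker ⊆ I^{ndN-d}/I^{ndN}` of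
dimension `≤ d (ndN)^{n-1}` (domain + order of vanishing), contradiction; so `J ⊆ I^{d+1}` and
Nakayama gives `I^d ⊆ (t)`. Mathlib: `MvPowerSeries` is a domain (`NoZeroDivisors`), `order`,
monomial counting for `dim_k k[[X]]/I^M`. [DeSmitRubinSchoof1997, Lemma 4.1] -/
theorem drs_lemma41 {k : Type u} [Field k] {n : ℕ} (hn : 1 ≤ n)
    {A : Type v} [CommRing A] [Algebra k A] [Algebra (MvPowerSeries (Fin n) k) A]
    [IsScalarTower k (MvPowerSeries (Fin n) k) A]
    (f : MvPowerSeries (Fin n) k →ₐ[k] A) (hf : Function.Surjective f)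
    (t : Fin n → MvPowerSeries (Fin n) k)
    (ht : ∀ i, f (t i) = algebraMap (MvPowerSeries (Fin n) k) A (MvPowerSeries.X i))
    {d N : ℕ}
    [Module.Finite k (A ⧸ Ideal.span (Set.range fun i => f (t i)))]
    (hd : Module.finrank k (A ⧸ Ideal.span (Set.range fun i => f (t i))) = d)
    (hN : n ^ (n - 1) * d ^ n < N)
    (hg : (Ideal.span (Set.range fun i => f (t i) ^ N)).comap
            (algebraMap (MvPowerSeries (Fin n) k) A) ≤
          Ideal.span (Set.range fun i => (MvPowerSeries.X i : MvPowerSeries (Fin n) k) ^ N)) :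
    RingHom.ker f ≤ Ideal.span (Set.range t) := by
  sorry

/-- **E2b = DRS Corollary 4.2** (size M given E2a). `O` Noetherian local with `char k = p`
(completeness of `O` is not used), `n ≥ 1`, `A` an `O`-algebra with S-structure `O[[S]] → A` and
surjective X-structure `f : O[[X]] ↠ A`, lifts `t i` of the `s_i`; `A/(s)A` free of rank `d > 0`
over `O`; ONE `m` with `p^m > n^{n-1} d^n` such that `A/J_m A` is finite flat over `O[[S]]/J_m`.
Then `ker f ⊆ (t)`, i.e. `O[[X]]/(t_1,…,t_n) ≅ A/(s)A` — an isomorphism between complete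
intersections over `O` (`IsCompleteIntersectionOver` is then immediate for both sides: `n`
variables, `n` relations). Proof: reduce mod `𝔪_O` (`ω_m(S) ≡ S^{p^m}`, a free module over the
local ring `k[[S]]/(S^{p^m})` of positive rank makes `ḡ` injective), E2a with `N = p^m`, then
Nakayama as in DRS Lemma 3.1 (tree: `injective_of_residually_injective` is the DVR-with-augmentation
form; the general 5-line form is re-proved here). [DeSmitRubinSchoof1997, Cor. 4.2] -/
theorem drs_corollary42 {O : Type u} [CommRing O] [IsLocalRing O] [IsNoetherianRing O]
    {p : ℕ} [Fact p.Prime] [CharP (ResidueField O) p] {n : ℕ} (hn : 1 ≤ n)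
    {A : Type v} [CommRing A] [Algebra O A] [Algebra (MvPowerSeries (Fin n) O) A]
    [IsScalarTower O (MvPowerSeries (Fin n) O) A]
    (f : MvPowerSeries (Fin n) O →ₐ[O] A) (hf : Function.Surjective f)
    (t : Fin n → MvPowerSeries (Fin n) O)
    (ht : ∀ i, f (t i) = algebraMap (MvPowerSeries (Fin n) O) A (MvPowerSeries.X i))
    {d m : ℕ} (hd0 : 0 < d)
    [Module.Finite O (A ⧸ Ideal.span (Set.range fun i => f (t i)))]
    [Module.Free O (A ⧸ Ideal.span (Set.range fun i => f (t i)))]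
    (hd : Module.finrank O (A ⧸ Ideal.span (Set.range fun i => f (t i))) = d)
    (hm : n ^ (n - 1) * d ^ n < p ^ m)
    [Module.Finite (MvPowerSeries (Fin n) O ⧸ J O p n m)
      (A ⧸ (J O p n m).map (algebraMap (MvPowerSeries (Fin n) O) A))]
    [Module.Flat (MvPowerSeries (Fin n) O ⧸ J O p n m)
      (A ⧸ (J O p n m).map (algebraMap (MvPowerSeries (Fin n) O) A))] :
    RingHom.ker f ≤ Ideal.span (Set.range t) := by
  sorry

/-- **E2c = DRS Criterion II, ONE-LEVEL form** (size S/M given E2b; Rubin: "avoids the original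
non-canonical limiting process"). Data as printed (p. 345) for a SINGLE `m` with
`p^m > n^{n-1} (rank_O T)^n`: `O[[S]] → R_m →φ_m T_m` over `R →φ T` with (i) `O[[X]] ↠ R_m`,
(ii) `φ_m` surjective, (iii) `R_m/J_0 R_m ≅ R`, `T_m/J_0 T_m ≅ T` (vertical maps surjective with
kernel `J_0 ·`), (iv) `T_m/J_m T_m` finite flat over `O[[S]]/J_m`; `T` local, finite free over `O`
(standing hypotheses p. 344). Then `φ` is an isomorphism between complete intersections over
`O` — typed as `φ` bijective and `T ≅ O[[X_1..X_n]]/(r_1, …, r_n)` with the SAME `n` (this is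
the tree's `Literature.RingTheory.CompleteIntersection.IsCompleteIntersectionOver O T`, witnessed
with `n` variables, and `R ≅ T`; the tree predicate is not imported here only because its module was
mid-rebuild on the farm when this file was checked — provers restate the conclusion with it). From E2b
with `A = T_m`, `f = φ_m ∘ (O[[X]] ↠ R_m)`, `t i` = lifts of the images of `S_i` in `R_m`:
`ker f ⊆ (t)` gives `R_m/J_0 → T_m/J_0` injective, hence `φ` bijective by (iii), and
`T ≅ O[[X]]/(t_1,…,t_n)`. The printed `∀ m > 0` Criterion II follows by choosing `m`. Feeds F_B2
(`R_∅ ≅ T_∅` for `ρ̄_{W,3}`) once the Taylor–Wiles level-`m` datum (named fact G1, DDT 1995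
Thm 2.49 + TW 1995 §§2–3) supplies (i)–(iv). [DeSmitRubinSchoof1997, Criterion II and §4] -/
theorem drs_criterionII_oneLevel {O : Type u} [CommRing O] [IsLocalRing O] [IsNoetherianRing O]
    {p : ℕ} [Fact p.Prime] [CharP (ResidueField O) p] {n : ℕ} (hn : 1 ≤ n)
    {R T : Type v} [CommRing R] [Algebra O R] [CommRing T] [Algebra O T] [IsLocalRing T]
    [Module.Finite O T] [Module.Free O T] (φ : R →ₐ[O] T)
    {Rm Tm : Type v} [CommRing Rm] [CommRing Tm] [Algebra O Rm] [Algebra O Tm]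
    [Algebra (MvPowerSeries (Fin n) O) Rm] [Algebra (MvPowerSeries (Fin n) O) Tm]
    [IsScalarTower O (MvPowerSeries (Fin n) O) Rm] [IsScalarTower O (MvPowerSeries (Fin n) O) Tm]
    (φm : Rm →ₐ[MvPowerSeries (Fin n) O] Tm) (vR : Rm →ₐ[O] R) (vT : Tm →ₐ[O] T)
    (hcomm : ∀ x, vT (φm x) = φ (vR x))
    (hi : ∃ g : MvPowerSeries (Fin n) O →ₐ[O] Rm, Function.Surjective g)
    (hii : Function.Surjective φm)
    (hvR : Function.Surjective vR)
    (hkR : RingHom.ker vR = (J O p n 0).map (algebraMap (MvPowerSeries (Fin n) O) Rm))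
    (hvT : Function.Surjective vT)
    (hkT : RingHom.ker vT = (J O p n 0).map (algebraMap (MvPowerSeries (Fin n) O) Tm))
    {m : ℕ} (hm : n ^ (n - 1) * (Module.finrank O T) ^ n < p ^ m)
    [Module.Finite (MvPowerSeries (Fin n) O ⧸ J O p n m)
      (Tm ⧸ (J O p n m).map (algebraMap (MvPowerSeries (Fin n) O) Tm))]
    [Module.Flat (MvPowerSeries (Fin n) O ⧸ J O p n m)
      (Tm ⧸ (J O p n m).map (algebraMap (MvPowerSeries (Fin n) O) Tm))] :
    Function.Bijective φ ∧
      ∃ r : Fin n → MvPowerSeries (Fin n) O,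
        Nonempty ((MvPowerSeries (Fin n) O ⧸ Ideal.span (Set.range r)) ≃ₐ[O] T) := by
  sorry

end DRS

end Summit.ABC.ABC.Cruxes.FreyModularity.StubIdeas2

end
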